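import Literature.MathematicalPhysics.QuantumFieldTheory.Balaban1983to89.Node00.CriticalOnFibre
import Literature.MathematicalPhysics.QuantumFieldTheory.Balaban1983to89.Node00.DomainsRefinement
import Literature.MathematicalPhysics.QuantumFieldTheory.Balaban1983to89.B14Eq216Concrete
import HarnessLib

/-!
# N07 [B11] ∕ K0⁷ road, chart side — MODULE 102: **SURGERY OF PRINT'S CURVE-CRITICALITY AT THE PINNED LEVEL-0 CELLS** — if every fine bond off an inner region `R₁` is a
# level-0 cell of the (2.3) family `D` ([B6] (2.3): `Λ₀ = Ω₁ᶜ`, `(Q₀A)(b) = A(b)`), then print's criticality on the `D`-fibre passes from `U` to ANY configuration `Ũ` agreeing with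
# `U` on a collar region `R₀` of `R₁` (one plaquette + the feeding bonds of every cell): the K0 road's «`U^u` versus the globally read `e^{iηA}`» step of (d′)

Cell `pub-ymgap`, seat `pub-ymgap-dag-n07-e` g29 (FAN-OUT §N07 row s3; LANE OWNER of the K0 road chart side), MODULE 102 = repair (R2)(b) of ⚑ LOCATED-DPRIME-CALIBRATION (desk memo
2026-08-29; companion of MODULE 101 `Node00/DomainsRefinementNonlinear`).  `--kind proof --supports stmt-QuantumFields-20541 --as helper` (K0⁷); count-neutral; theorems only.
[15] = [Balaban1985Variational]; [B6] = [Balaban1984PropagatorsII]; [I] = [Balaban1987RG1]; [III] = [Balaban1988Convergent].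

WHY.  Print ([15] pp. 301–303) works on the cube tower `□₀ ⊃ □₁ ⊃ … ⊃ □_k` with the family (150) and the axial-gauge potential `U′_k = e^{iηA}` ON THE TOWER; the k0-s1 supplier of the
(d′) letter (S4 `…K0Stub1Letters10OnA1OfFlatSocket`) reads the charted configuration `e^{iη(A′ − H·Dsel A′)}` on EVERY bond of the torus and asks it to be critical on the fibre.  The
record's object is the gauge copy `U^u`, which equals `e^{iηA}` only on the tower ((T1) of the head token).  The bridge is a surgery: outside `□₁` every fine bond is a level-0 cell of
the family (its `1`-block is not in `Ω₁^{(1)} ⊆ □₁`), so a curve in the fibre through `Ũ := e^{iηA}` (read globally) is FROZEN off `□₁` near `t = 0`; splice it with `U^u` off the collar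
region `R₀ = π″□₀`: the spliced curve passes through `U^u`, lies in the fibre of `U^u` (every cell reads its average inside `R₀`, where the two curves agree, or entirely off `R₁`,
where both are frozen), and its Wilson action differs from the original's by a constant (a plaquette meets `R₁` only inside `R₀`; plaquettes off `R₀` are frozen on both sides) — so
the derivatives at `0` coincide, and print's criticality of `U^u` gives that of `Ũ`.  This file proves exactly this, ABSTRACTLY in two regions `R₀`, `R₁` (three displayed geometric
hypotheses: pinning off `R₁`, the one-plaquette collar, the feeding-bond alternative), at NODE 00's objects (`avOfRecord`, `wilsonAction4`, the (2.3) `LamBond` fibre in the curve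
form of `Node00.IsCritOnFibre` ∕ `…N07CritMultiScaleLamBond`).  The instantiation at the K0 road's tower (`cubeDomains ⊓ domainsOfSeq`, `R₀ = (regionOfSet (π″□₀)).bonds`) is the
next module; nothing here depends on the reading seam (b)∕(ii) — the file lives in the (2.3) world.

WHAT IS PROVED (sorry-free; no definition; axioms standard).  ★ `plaqTerm_splice_sub_eq` (per-plaquette bookkeeping of the splice); ★★★ `critLam_surgery` — for a (2.3) family `D` on
the record's torus, regions `R₀`, `R₁` of fine bonds (no inclusion needed) with (i) every bond off `R₁` a level-0 `D`-cell, (ii) every plaquette meeting `R₁` inside `R₀`, (iii) every `D`-cell's feeding bonds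
(`B14.Eq216Concrete.feeds`, [III] (2.11)) inside `R₀` or off `R₁`; a datum `W` and `U` on the `D`-fibre of `W`, curve-critical there; and ANY `Ũ` with `Ũ = U` on `R₀`: `Ũ` is
curve-critical on the `D`-fibre of its own averages.
HONEST FRAMING: lattice bookkeeping + one-variable calculus (`HasDerivAt.congr_of_eventuallyEq`); NOTHING of [15]'s estimates asserted; (d′) ∕ `HThm4RecDbar` ∕ the budget row of
MODULE 100 untouched; K0⁷ NOT closed; N07 NOT discharged; counts unmoved; one finite 𝕋⁴ programme at fixed ε — NOT continuum ∕ ℝ⁴ ∕ OS ∕ mass gap ∕ Clay.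
No `sorry`, no `def`, no `instance`, no `notation`.

References: [15] (5)–(6) p.278, (144) p.300, (147)–(152) p.301, Prop. 8 p.304; [B6] (2.1)–(2.3) p.224, (2.20) p.226; [I] (0.2)–(0.4) pp.252–253; [III] (2.10)–(2.12) p.256.
-/

set_option autoImplicit false

noncomputable section

open scoped Matrix.Norms.L2Operator Topology BigOperators
open Filter

namespace Summit.QuantumFields.YangMills.BalabanUVNodes.N07CritLamSurgery

open Literature.MathematicalPhysics.QuantumFieldTheory.Balaban1983to89
open Literature.MathematicalPhysics.QuantumFieldTheory.Balaban1983to89.T4Continuum (T4Family)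
open Literature.MathematicalPhysics.QuantumFieldTheory.Balaban1983to89.B15DeterminingSets
open Literature.MathematicalPhysics.QuantumFieldTheory.Balaban1983to89.B6SectADomainsV1 (Domains)
open Literature.MathematicalPhysics.QuantumFieldTheory.Balaban1983to89.B14.Eq216Concrete (feeds iter_local)
open Literature.MathematicalPhysics.QuantumFieldTheory.Balaban1983to89.Node00

variable {F : T4Family} {N : ℕ} [NeZero N] {K : ℕ}

/-! ## §1  Per-plaquette bookkeeping of the splice -/

/-- ★ **THE SPLICE CHANGES EACH PLAQUETTE TERM BY A CONSTANT.**  Four configurations `V′, V, U, Ũ` of one level with: `V′ = V` and `U = Ũ` on the bonds of `R₀`, and, on the four bonds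
of a plaquette `p` NOT all in `R₀`, `V′ = U` and `V = Ũ`; then `term_p(V′) − term_p(V) = term_p(U) − term_p(Ũ)` for the Wilson term `1 − Re tr(∂p)`.
[cite: Balaban1987RG1, (0.2) p.252 (bookkeeping)] -/
theorem plaqTerm_splice_sub_eq {j : ℕ} {R₀ : Set (PBond (F.P K) j)} {V' V U Ut : GaugeField (F.P K) j (SU N)} (p : Plaq (F.P K) j)
    (hV : ∀ b ∈ R₀, V' b = V b) (hU : ∀ b ∈ R₀, Ut b = U b)
    (hoff : ¬ ((⟨p.src, p.μ⟩ : PBond (F.P K) j) ∈ R₀ ∧ (⟨p.src.shift p.μ, p.ν⟩ : PBond (F.P K) j) ∈ R₀ ∧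
        (⟨p.src.shift p.ν, p.μ⟩ : PBond (F.P K) j) ∈ R₀ ∧ (⟨p.src, p.ν⟩ : PBond (F.P K) j) ∈ R₀) →
      (V' ⟨p.src, p.μ⟩ = U ⟨p.src, p.μ⟩ ∧ V' ⟨p.src.shift p.μ, p.ν⟩ = U ⟨p.src.shift p.μ, p.ν⟩ ∧
        V' ⟨p.src.shift p.ν, p.μ⟩ = U ⟨p.src.shift p.ν, p.μ⟩ ∧ V' ⟨p.src, p.ν⟩ = U ⟨p.src, p.ν⟩) ∧
      (V ⟨p.src, p.μ⟩ = Ut ⟨p.src, p.μ⟩ ∧ V ⟨p.src.shift p.μ, p.ν⟩ = Ut ⟨p.src.shift p.μ, p.ν⟩ ∧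
        V ⟨p.src.shift p.ν, p.μ⟩ = Ut ⟨p.src.shift p.ν, p.μ⟩ ∧ V ⟨p.src, p.ν⟩ = Ut ⟨p.src, p.ν⟩)) :
    (1 - GaugeGroup.reTr (GaugeField.plaqHol V' p)) - (1 - GaugeGroup.reTr (GaugeField.plaqHol V p)) =
      (1 - GaugeGroup.reTr (GaugeField.plaqHol U p)) - (1 - GaugeGroup.reTr (GaugeField.plaqHol Ut p)) := by
  by_cases hall : (⟨p.src, p.μ⟩ : PBond (F.P K) j) ∈ R₀ ∧ (⟨p.src.shift p.μ, p.ν⟩ : PBond (F.P K) j) ∈ R₀ ∧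
      (⟨p.src.shift p.ν, p.μ⟩ : PBond (F.P K) j) ∈ R₀ ∧ (⟨p.src, p.ν⟩ : PBond (F.P K) j) ∈ R₀
  · obtain ⟨h1, h2, h3, h4⟩ := hall
    have hp1 : GaugeField.plaqHol V' p = GaugeField.plaqHol V p := by
      simp only [GaugeField.plaqHol, hV _ h1, hV _ h2, hV _ h3, hV _ h4]
    have hp2 : GaugeField.plaqHol Ut p = GaugeField.plaqHol U p := by
      simp only [GaugeField.plaqHol, hU _ h1, hU _ h2, hU _ h3, hU _ h4]
    rw [hp1, hp2, sub_self, sub_self]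
  · obtain ⟨⟨a1, a2, a3, a4⟩, ⟨b1, b2, b3, b4⟩⟩ := hoff hall
    have hp1 : GaugeField.plaqHol V' p = GaugeField.plaqHol U p := by
      simp only [GaugeField.plaqHol, a1, a2, a3, a4]
    have hp2 : GaugeField.plaqHol V p = GaugeField.plaqHol Ut p := by
      simp only [GaugeField.plaqHol, b1, b2, b3, b4]
    rw [hp1, hp2]

/-! ## §2  The surgery theorem -/

/-- ★★★ **SURGERY OF PRINT'S CURVE-CRITICALITY AT THE PINNED LEVEL-0 CELLS.**  `D` a (2.3) family on the record's `K`-th torus; `R₀`, `R₁` sets of fine bonds with: (i) every bond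
off `R₁` is a level-0 `D`-cell (`Λ₀ = Ω₁ᶜ`: its end `1`-blocks are not in `Ω₁^{(1)}`); (ii) a plaquette with a bond in `R₁` has all four bonds in `R₀`; (iii) for every `D`-cell `c`
the fine bonds feeding `Ū^j(·)(c)` ([III] (2.11), the tree's `feeds`) lie inside `R₀` or all off `R₁`.  If `U` lies on the `D`-fibre of `W` and is curve-critical there (print's
«critical configuration of (5) in (150)», curve form), then every `Ũ` with `Ũ = U` on `R₀` is curve-critical on the `D`-fibre of its own averages `Ū(Ũ)`.  Proof: splice a fibre curve
`γ` through `Ũ` with `U` off `R₀`; near `t = 0` the pinned cells freeze `γ` off `R₁` at `Ũ`, so the splice lies in the fibre of `W` through `U` (cells fed inside `R₀` read `γ`, whose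
averages are `Ū(Ũ) = Ū(U) = W` there; cells fed off `R₁` read `U`), and its action differs from `γ`'s by the constant `A(U) − A(Ũ)` (§1 per plaquette), so the derivatives at `0` agree.
[cite: Balaban1985Variational, (5)–(6) p.278, (150)–(152) p.301, Prop. 8 p.304; Balaban1984PropagatorsII, (2.3) p.224, (2.20) p.226; Balaban1988Convergent, (2.10)–(2.12) p.256; Balaban1987RG1, (0.2) p.252] -/
theorem critLam_surgery {D : Domains (F.P K)} {R₀ R₁ : Set (PBond (F.P K) 0)}
    (hpin : ∀ b : PBond (F.P K) 0, b ∉ R₁ → D.LamBond 0 b)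
    (hcollar : ∀ p : Plaq (F.P K) 0,
      ((⟨p.src, p.μ⟩ : PBond (F.P K) 0) ∈ R₁ ∨ (⟨p.src.shift p.μ, p.ν⟩ : PBond (F.P K) 0) ∈ R₁ ∨
        (⟨p.src.shift p.ν, p.μ⟩ : PBond (F.P K) 0) ∈ R₁ ∨ (⟨p.src, p.ν⟩ : PBond (F.P K) 0) ∈ R₁) →
      ((⟨p.src, p.μ⟩ : PBond (F.P K) 0) ∈ R₀ ∧ (⟨p.src.shift p.μ, p.ν⟩ : PBond (F.P K) 0) ∈ R₀ ∧
        (⟨p.src.shift p.ν, p.μ⟩ : PBond (F.P K) 0) ∈ R₀ ∧ (⟨p.src, p.ν⟩ : PBond (F.P K) 0) ∈ R₀))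
    (hfeeds : ∀ (j : ℕ) (c : PBond (F.P K) j), D.LamBond j c → feeds j c ⊆ R₀ ∨ Disjoint (feeds j c) R₁)
    {W : MSField (F.P K) (SU N)} {U Ut : GaugeField (F.P K) 0 (SU N)} (hagree : ∀ b ∈ R₀, Ut b = U b)
    (hUW : ∀ (j : ℕ) (c : PBond (F.P K) j), D.LamBond j c → avgFamily (avOfRecord F N K) U j c = W j c)
    (hcrit : ∀ γ : ℝ → GaugeField (F.P K) 0 (SU N), γ 0 = U →
      DifferentiableAt ℝ (fun (t : ℝ) (b : PBond (F.P K) 0) => ((γ t b : SU N) : Matrix (Fin N) (Fin N) ℂ)) 0 →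
        (∀ᶠ t in 𝓝 (0 : ℝ), ∀ (j : ℕ) (c : PBond (F.P K) j), D.LamBond j c → avgFamily (avOfRecord F N K) (γ t) j c = W j c) →
          ∀ a : ℝ, HasDerivAt (fun t => wilsonAction4 (γ t)) a 0 → a = 0) :
    ∀ γ : ℝ → GaugeField (F.P K) 0 (SU N), γ 0 = Ut →
      DifferentiableAt ℝ (fun (t : ℝ) (b : PBond (F.P K) 0) => ((γ t b : SU N) : Matrix (Fin N) (Fin N) ℂ)) 0 →
        (∀ᶠ t in 𝓝 (0 : ℝ), ∀ (j : ℕ) (c : PBond (F.P K) j), D.LamBond j c →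
          avgFamily (avOfRecord F N K) (γ t) j c = avgFamily (avOfRecord F N K) Ut j c) →
          ∀ a : ℝ, HasDerivAt (fun t => wilsonAction4 (γ t)) a 0 → a = 0 := by
  classical
  intro γ hγ0 hd hfib a ha
  -- the splice: `γ` on `R₀`, `U` off `R₀`
  set γ' : ℝ → GaugeField (F.P K) 0 (SU N) := fun t b => if b ∈ R₀ then γ t b else U b with hγ'
  -- near `t = 0` the pinned cells freeze `γ` off `R₁` at `Ũ`
  have hpinned : ∀ᶠ t in 𝓝 (0 : ℝ), ∀ b : PBond (F.P K) 0, b ∉ R₁ → γ t b = Ut b :=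
    hfib.mono fun t ht b hb => ht 0 b (hpin b hb)
  -- the splice passes through `U`
  have h0 : γ' 0 = U := by
    funext b
    by_cases hb : b ∈ R₀
    · simp only [hγ', hb, if_true, hγ0, hagree b hb]
    · simp only [hγ', hb, if_false]
  -- it is differentiable at `0` as a curve of bond matrices
  have hd' : DifferentiableAt ℝ (fun (t : ℝ) (b : PBond (F.P K) 0) => ((γ' t b : SU N) : Matrix (Fin N) (Fin N) ℂ)) 0 := by
    rw [differentiableAt_pi]
    intro b
    by_cases hb : b ∈ R₀
    · have hcomp := (differentiableAt_pi.1 hd) b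
      simp only [hγ', hb, if_true]
      exact hcomp
    · simp only [hγ', hb, if_false]
      exact differentiableAt_const _
  -- it lies in the `D`-fibre of `W` near `t = 0`
  have hfib' : ∀ᶠ t in 𝓝 (0 : ℝ), ∀ (j : ℕ) (c : PBond (F.P K) j), D.LamBond j c → avgFamily (avOfRecord F N K) (γ' t) j c = W j c := by
    filter_upwards [hfib, hpinned] with t ht hp j c hc
    have hjr : j ≤ (F.P K).m + (F.P K).K := (D.le_of_lamBond hc).trans D.hk
    rcases hfeeds j c hc with hsub | hdis
    · calc avgFamily (avOfRecord F N K) (γ' t) j c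
          = avgFamily (avOfRecord F N K) (γ t) j c :=
            iter_local (avOfRecord F N K) j hjr _ _ c fun b₀ hb₀ => by simp only [hγ', hsub hb₀, if_true]
        _ = avgFamily (avOfRecord F N K) Ut j c := ht j c hc
        _ = avgFamily (avOfRecord F N K) U j c :=
            iter_local (avOfRecord F N K) j hjr _ _ c fun b₀ hb₀ => hagree b₀ (hsub hb₀)
        _ = W j c := hUW j c hc
    · calc avgFamily (avOfRecord F N K) (γ' t) j c
          = avgFamily (avOfRecord F N K) U j c :=
            iter_local (avOfRecord F N K) j hjr _ _ c fun b₀ hb₀ => by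
              have hb₁ : b₀ ∉ R₁ := fun h => (Set.disjoint_left.1 hdis) hb₀ h
              by_cases hb : b₀ ∈ R₀
              · simp only [hγ', hb, if_true]
                rw [hp b₀ hb₁, hagree b₀ hb]
              · simp only [hγ', hb, if_false]
        _ = W j c := hUW j c hc
  -- its action differs from `γ`'s by the constant `A(U) − A(Ũ)` near `t = 0`
  have hdiff : (fun t => wilsonAction4 (γ t) + (wilsonAction4 U - wilsonAction4 Ut)) =ᶠ[𝓝 (0 : ℝ)] fun t => wilsonAction4 (γ' t) := by
    filter_upwards [hpinned] with t hp
    have key : ∀ p : Plaq (F.P K) 0,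
        (1 - GaugeGroup.reTr (GaugeField.plaqHol (γ' t) p)) - (1 - GaugeGroup.reTr (GaugeField.plaqHol (γ t) p)) =
          (1 - GaugeGroup.reTr (GaugeField.plaqHol U p)) - (1 - GaugeGroup.reTr (GaugeField.plaqHol Ut p)) := by
      intro p
      refine plaqTerm_splice_sub_eq (R₀ := R₀) p (fun b hb => by simp only [hγ', hb, if_true]) hagree fun hoff => ?_
      -- not all four bonds in `R₀`: by the collar, none of them is in `R₁`, so both curves are frozen there
      have hnone : (⟨p.src, p.μ⟩ : PBond (F.P K) 0) ∉ R₁ ∧ (⟨p.src.shift p.μ, p.ν⟩ : PBond (F.P K) 0) ∉ R₁ ∧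
          (⟨p.src.shift p.ν, p.μ⟩ : PBond (F.P K) 0) ∉ R₁ ∧ (⟨p.src, p.ν⟩ : PBond (F.P K) 0) ∉ R₁ := by
        refine ⟨fun h => hoff (hcollar p (Or.inl h)), fun h => hoff (hcollar p (Or.inr (Or.inl h))),
          fun h => hoff (hcollar p (Or.inr (Or.inr (Or.inl h)))), fun h => hoff (hcollar p (Or.inr (Or.inr (Or.inr h))))⟩
      have hfrz : ∀ b : PBond (F.P K) 0, b ∉ R₁ → γ' t b = U b := by
        intro b hb
        by_cases hb₀ : b ∈ R₀
        · simp only [hγ', hb₀, if_true]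
          rw [hp b hb, hagree b hb₀]
        · simp only [hγ', hb₀, if_false]
      exact ⟨⟨hfrz _ hnone.1, hfrz _ hnone.2.1, hfrz _ hnone.2.2.1, hfrz _ hnone.2.2.2⟩,
        ⟨hp _ hnone.1, hp _ hnone.2.1, hp _ hnone.2.2.1, hp _ hnone.2.2.2⟩⟩
    have hgoal : ∑ p : Plaq (F.P K) 0, (1 - GaugeGroup.reTr (GaugeField.plaqHol (γ' t) p)) =
        ∑ p : Plaq (F.P K) 0, (1 - GaugeGroup.reTr (GaugeField.plaqHol (γ t) p)) +
          (∑ p : Plaq (F.P K) 0, (1 - GaugeGroup.reTr (GaugeField.plaqHol U p)) -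
            ∑ p : Plaq (F.P K) 0, (1 - GaugeGroup.reTr (GaugeField.plaqHol Ut p))) := by
      rw [← Finset.sum_sub_distrib, ← Finset.sum_add_distrib]
      exact Finset.sum_congr rfl fun p _ => by linarith [key p]
    simp only [wilsonAction4, wilsonAction, one_mul]
    exact hgoal.symm
  -- hence the same derivative at `0`, and print's criticality of `U` concludes
  have ha' : HasDerivAt (fun t => wilsonAction4 (γ' t)) a 0 := by
    have h2 : HasDerivAt (fun t => wilsonAction4 (γ t) + (wilsonAction4 U - wilsonAction4 Ut)) a 0 := by
      simpa using ha.add_const (wilsonAction4 U - wilsonAction4 Ut)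
    exact h2.congr_of_eventuallyEq hdiff.symm
  exact hcrit γ' h0 hd' hfib' a ha'

end Summit.QuantumFields.YangMills.BalabanUVNodes.N07CritLamSurgery

end
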